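import Summits.KontsevichZagierPeriods.KontsevichZagierPeriods.Theorems.HurwitzMicroSectorsNormalFormPrincipleAlgVanishing
import Summits.KontsevichZagierPeriods.KontsevichZagierPeriods.Theorems.AbelContractionRealHyperellipticSectorPortAffineMove
import Summits.KontsevichZagierPeriods.KontsevichZagierPeriods.Theorems.AbelContractionRealHyperellipticSectorPortSiegeNfAPoleOneK3
import Summits.KontsevichZagierPeriods.KontsevichZagierPeriods.Theorems.AbelContractionRealHyperellipticSectorPortAlgNormalForm

/-!
# Route AbelContraction — `RealHyperellipticSector` (crux stmt-KontsevichZagierPeriods-12475):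
# the dimension-certified port, layer 5 — Conjecture 1 in dimension one for denominators with real roots

Helper file of the line `Lines/birth.lean` (stub `stub_bakerAlg`, `--supports` the crux): the port
of `Theorems/HurwitzMicroSectorsNormalFormPrincipleAlgVanishing.lean` (namespace
`…NormalFormPrinciple.PiBox.Dlog`) INTO THE BUDGET `KZ.relationsLE 1`: every `[(0,1), p/q]` whose
denominator splits over the real algebraic numbers is in algebraic normal form in
`FormalRep ⧸ relationsLE 1` (`nfA_of_split`); re-expansion of the carriers on a multiplicative
basis (`carrierA_monomial_eq`) and Baker (`eq_zero_of_alg_add_sum_mul_log_eq_zero`, reused) give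
`box_algsplit_mem_relationsLE` (registered sub-goal: value `0` ⇒ `[N] ∈ relationsLE 1`) and the
rigidity theorem `box_realsplit_equivalentLE_of_value_eq` (`KZ.EquivalentLE 1`). Every move is
among representations of dimension `≤ 1` (`Port.Dlog.*`, `Port.Kit.*`, the budget kit).

The dimension-free lemmas (`splits_algClosure_of_splits_real`, `exists_mulBasis`,
`isAlgebraic_prod_zpow`, `eq_zero_of_alg_add_sum_mul_log_eq_zero`, `BoxAlgSplitK4.exists_peel_poleK`,
`AlgSplitK5.exists_repK_unit`, `exists_rep_unit`, `value_pt`, `value_dlogA`, the carrier families)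
are reused from the originals.

Sources: M. Kontsevich, D. Zagier, *Periods* (2001), §1.2 Conjecture 1 [KontsevichZagier2001];
A. Baker, *Transcendental Number Theory* (1975), Thm. 2.1. No definitions are introduced.
-/

noncomputable section

open MeasureTheory Set
open scoped Polynomial
open Literature.NumberTheory.Transcendental Literature.NumberTheory.Transcendental.KZ
open Literature.ModelTheory.ExponentialFields (IsSemialgebraic)
open Summit.KontsevichZagierPeriods.AbelContraction.AbelContractionLemma
  (mem_relationsLE_of_integrandAdd)

namespace Summit.KontsevichZagierPeriods.AbelContraction.RealHyperellipticSector.Port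

namespace Dlog

open Summit.KontsevichZagierPeriods.HurwitzMicroSectors.NormalFormPrinciple
  (BoxAlgSplitK4.exists_peel_poleK)
open Summit.KontsevichZagierPeriods.HurwitzMicroSectors.NormalFormPrinciple.PiBox
  (AlgSplitK5.exists_repK_unit AlgSplitK5.isAlgebraic_coeK)
open Summit.KontsevichZagierPeriods.HurwitzMicroSectors.NormalFormPrinciple.PiBox.Dlog
  (exists_carrierA exists_ptCarrierA exists_mulBasis isAlgebraic_prod_zpow
    eq_zero_of_alg_add_sum_mul_log_eq_zero splits_algClosure_of_splits_real exists_rep_unit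
    value_pt value_dlogA)

variable {RA : ℝ → ℝ → ℝ → IntegralRep 1} {ZA : ℝ → IntegralRep 0}

/-- **Every box-rational representation whose denominator splits over the real algebraic numbers is in
algebraic normal form** (induction on `deg q`, one `BoxAlgSplitK4.exists_peel_poleK` step at a time).
(inside the budget `relationsLE 1`) [cite: KontsevichZagier2001, §1.2] -/
theorem nfA_of_split
    (hR : ∀ a b c, IsAlgebraic ℚ a → IsAlgebraic ℚ b → IsAlgebraic ℚ c → 0 < a →
      (RA a b c).domain = {x | x 0 ∈ Set.Ioo a b} ∧ (RA a b c).integrand = fun x => c / x 0)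
    (hZ : ∀ r, IsAlgebraic ℚ r → (ZA r).domain = univ ∧ (ZA r).integrand = fun _ => r) :
    ∀ (d : ℕ) (p q : (algebraicClosure ℚ ℝ)[X]) (N : IntegralRep 1), q ≠ 0 → q.natDegree ≤ d →
      q.Splits → (∀ t ∈ Set.Icc (0:ℝ) 1, (Polynomial.aeval t q : ℝ) ≠ 0) →
      N.domain = {x | x 0 ∈ Set.Ioo (0:ℝ) 1} →
      EqOn N.integrand (fun x => (Polynomial.aeval (x 0) p : ℝ) / Polynomial.aeval (x 0) q) N.domain →
      ∃ (r : ℝ) (k : ℕ) (u c : Fin k → ℝ), IsAlgebraic ℚ r ∧ (∀ j, 1 < u j) ∧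
        (∀ j, IsAlgebraic ℚ (u j)) ∧ (∀ j, IsAlgebraic ℚ (c j)) ∧
        QuotientAddGroup.mk' (relationsLE 1) (of N) = QuotientAddGroup.mk' (relationsLE 1) (of (ZA r)) +
          ∑ j, QuotientAddGroup.mk' (relationsLE 1) (of (RA 1 (u j) (c j))) := by
  intro d
  induction d with
  | zero =>
    intro p q N hq hdeg _ _ hNd hNi
    obtain ⟨q0, hq0⟩ : ∃ q0, q = Polynomial.C q0 :=
      ⟨q.coeff 0, Polynomial.eq_C_of_natDegree_eq_zero (Nat.le_zero.mp hdeg)⟩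
    have hc0 : q0 ≠ 0 := by
      intro h; apply hq; rw [hq0, h, map_zero]
    have e0 : (algebraMap (algebraicClosure ℚ ℝ) ℝ q0 : ℝ) = (q0 : ℝ) := rfl
    exact nfA_poly hZ p hc0 N hNd fun x hx => by
      rw [hNi hx]
      show (Polynomial.aeval (x 0) p : ℝ) / Polynomial.aeval (x 0) q = _
      rw [hq0, Polynomial.aeval_C, e0]
  | succ d ih =>
    intro p q N hq hdeg hsplit hq01 hNd hNi
    by_cases hd : q.natDegree ≤ d
    · exact ih p q N hq hd hsplit hq01 hNd hNi
    have hdeg' : q.natDegree = d + 1 := le_antisymm hdeg (Nat.lt_of_not_le hd)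
    have hdeg0 : q.degree ≠ 0 := by
      rw [Polynomial.degree_eq_natDegree hq, hdeg']; exact_mod_cast Nat.succ_ne_zero d
    obtain ⟨ρ, hρ⟩ := hsplit.exists_eval_eq_zero hdeg0
    have hρ01 : (ρ:ℝ) ∉ Set.Icc (0:ℝ) 1 := by
      intro h
      apply hq01 (ρ:ℝ) h
      have e : (ρ:ℝ) = algebraMap (algebraicClosure ℚ ℝ) ℝ ρ := rfl
      rw [e, Polynomial.aeval_algebraMap_apply_eq_algebraMap_eval, hρ, map_zero]
    obtain ⟨k, c, p₁, q₁, hq₁0, hq₁deg, hq₁dvd, hpeel⟩ := BoxAlgSplitK4.exists_peel_poleK p q hq hρ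
    obtain ⟨w, hw⟩ := hq₁dvd
    have hq₁01 : ∀ t ∈ Set.Icc (0:ℝ) 1, (Polynomial.aeval t q₁ : ℝ) ≠ 0 := by
      intro t ht h; apply hq01 t ht; rw [hw, map_mul, h, zero_mul]
    have hρt : ∀ t ∈ Set.Icc (0:ℝ) 1, t - (ρ:ℝ) ≠ 0 := by
      intro t ht h; apply hρ01; rw [sub_eq_zero] at h; rw [← h]; exact ht
    obtain ⟨T, hTd, hTi⟩ := AlgSplitK5.exists_repK_unit (Polynomial.C c)
      ((Polynomial.X - Polynomial.C ρ) ^ (k + 1)) fun t ht => by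
        simp only [map_pow, map_sub, Polynomial.aeval_X, Polynomial.aeval_C]
        exact pow_ne_zero _ (hρt t ht)
    have hTi' : ∀ x, T.integrand x = (c:ℝ) / (x 0 - ρ) ^ (k + 1) := by
      intro x; rw [hTi]; simp only [map_pow, map_sub, Polynomial.aeval_X, Polynomial.aeval_C]; rfl
    obtain ⟨N₁, hN₁d, hN₁i⟩ := AlgSplitK5.exists_repK_unit p₁ q₁ hq₁01
    have hsplit3 : of N - of T - of N₁ ∈ relationsLE 1 := by
      refine mem_relationsLE_of_integrandAdd le_rfl (by rw [hTd, hNd]) (by rw [hN₁d, hNd]) fun x hx => ?_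
      rw [hNi hx, Pi.add_apply, hTi', hN₁i]
      simp only
      have hx' : x 0 ∈ Set.Icc (0:ℝ) 1 := by rw [hNd] at hx; exact Set.Ioo_subset_Icc_self hx
      rw [hpeel (x 0) (hq01 (x 0) hx')]
      rfl
    have hcA : IsAlgebraic ℚ (c : ℝ) := AlgSplitK5.isAlgebraic_coeK c
    have hρA : IsAlgebraic ℚ (ρ : ℝ) := AlgSplitK5.isAlgebraic_coeK ρ
    have hT : ∃ (r : ℝ) (k : ℕ) (u c : Fin k → ℝ), IsAlgebraic ℚ r ∧ (∀ j, 1 < u j) ∧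
        (∀ j, IsAlgebraic ℚ (u j)) ∧ (∀ j, IsAlgebraic ℚ (c j)) ∧
        QuotientAddGroup.mk' (relationsLE 1) (of T) = QuotientAddGroup.mk' (relationsLE 1) (of (ZA r)) +
          ∑ j, QuotientAddGroup.mk' (relationsLE 1) (of (RA 1 (u j) (c j))) := by
      cases k with
      | zero => exact SiegeK3.nfA_pole_one hR hZ hcA hρA hρ01 T hTd fun x _ => by rw [hTi', zero_add, pow_one]
      | succ j => exact nfA_pole_high hZ hcA hρA hρ01 j T hTd fun x _ => by rw [hTi']
    have hN₁ := ih p₁ q₁ N₁ hq₁0 (by omega) (hsplit.of_dvd hq ⟨w, hw⟩) hq₁01 hN₁d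
      (by rw [hN₁i]; exact fun _ _ => rfl)
    obtain ⟨r, k', u, c', hr, hu1, hu, hc', hEq⟩ := nfA_add hZ hT hN₁
    refine ⟨r, k', u, c', hr, hu1, hu, hc', ?_⟩
    rw [← hEq]
    rw [← QuotientAddGroup.eq_zero_iff] at hsplit3
    change QuotientAddGroup.mk' (relationsLE 1) _ = 0 at hsplit3
    rwa [map_sub, map_sub, sub_sub, sub_eq_zero] at hsplit3

/-! ## The endgame: re-expansion on a multiplicative basis, and Baker -/

/-- **Carriers on a multiplicative basis**: if `u = ∏ᵢ εᵢ^{nᵢ}` exactly, with algebraic `εᵢ > 1`,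
`u > 1`, then `Λ(u, c) = Σᵢ nᵢ • Λ(εᵢ, c)` modulo `relationsLE 1` (`Λ` is multiplicative on the
monoid of algebraic reals `≥ 1` inside the budget: clear the negative exponents). [cite: KontsevichZagier2001, §1.2] -/
theorem carrierA_monomial_eq
    (hR : ∀ a b c, IsAlgebraic ℚ a → IsAlgebraic ℚ b → IsAlgebraic ℚ c → 0 < a →
      (RA a b c).domain = {x | x 0 ∈ Set.Ioo a b} ∧ (RA a b c).integrand = fun x => c / x 0)
    {s : ℕ} (ε : Fin s → ℝ) (hε1 : ∀ i, 1 < ε i) (hεA : ∀ i, IsAlgebraic ℚ (ε i))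
    (n : Fin s → ℤ) {u c : ℝ} (hu1 : 1 ≤ u) (huA : IsAlgebraic ℚ u) (hc : IsAlgebraic ℚ c)
    (hu : u = ∏ i, ε i ^ n i) :
    QuotientAddGroup.mk' (relationsLE 1) (of (RA 1 u c)) =
      ∑ i, n i • QuotientAddGroup.mk' (relationsLE 1) (of (RA 1 (ε i) c)) := by
  classical
  -- positive and negative parts of the exponents
  set np : Fin s → ℕ := fun i => (n i).toNat with hnp
  set nm : Fin s → ℕ := fun i => (-n i).toNat with hnm
  have hsplitn : ∀ i, (n i : ℤ) = np i - nm i := fun i => by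
    simp only [hnp, hnm]; omega
  set A : ℝ := ∏ i, ε i ^ np i with hA
  set B : ℝ := ∏ i, ε i ^ nm i with hB
  have hε0 : ∀ i, 0 < ε i := fun i => lt_trans one_pos (hε1 i)
  have one_le_prod_pow : ∀ (t : Finset (Fin s)) (m : Fin s → ℕ), 1 ≤ ∏ i ∈ t, ε i ^ m i := by
    intro t m
    calc (1:ℝ) = ∏ _i ∈ t, (1:ℝ) := Finset.prod_const_one.symm
      _ ≤ _ := Finset.prod_le_prod (fun _ _ => zero_le_one) fun i _ => one_le_pow₀ (hε1 i).le
  have hA1 : 1 ≤ A := one_le_prod_pow Finset.univ np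
  have hB1 : 1 ≤ B := one_le_prod_pow Finset.univ nm
  have hB0 : 0 < B := lt_of_lt_of_le one_pos hB1
  have hAalg : IsAlgebraic ℚ A := by
    rw [hA]
    have := isAlgebraic_prod_zpow Finset.univ ε (fun i => (np i : ℤ)) fun i _ => hεA i
    simpa using this
  have hBalg : IsAlgebraic ℚ B := by
    rw [hB]
    have := isAlgebraic_prod_zpow Finset.univ ε (fun i => (nm i : ℤ)) fun i _ => hεA i
    simpa using this
  -- `u * B = A`
  have huB : u * B = A := by
    rw [hu, hA, hB, ← Finset.prod_mul_distrib]
    refine Finset.prod_congr rfl fun i _ => ?_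
    rw [← zpow_natCast, ← zpow_natCast, ← zpow_add₀ (hε0 i).ne', hsplitn i]
    congr 1
    ring
  -- multiplicativity on products of elements `≥ 1`
  have hprod : ∀ (m : Fin s → ℕ), QuotientAddGroup.mk' (relationsLE 1) (of (RA 1 (∏ i, ε i ^ m i) c)) =
      ∑ i, (m i) • QuotientAddGroup.mk' (relationsLE 1) (of (RA 1 (ε i) c)) := by
    intro m
    have key : ∀ (t : Finset (Fin s)), QuotientAddGroup.mk' (relationsLE 1) (of (RA 1 (∏ i ∈ t, ε i ^ m i) c)) =
        ∑ i ∈ t, (m i) • QuotientAddGroup.mk' (relationsLE 1) (of (RA 1 (ε i) c)) := by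
      intro t
      induction t using Finset.induction_on with
      | empty =>
        rw [Finset.prod_empty, Finset.sum_empty]
        exact (QuotientAddGroup.eq_zero_iff _).mpr (carrierA_one_mem_relationsLE hR hc)
      | insert i t hi ih' =>
        have halg : IsAlgebraic ℚ (∏ j ∈ t, ε j ^ m j) := by
          have := isAlgebraic_prod_zpow t ε (fun j => (m j : ℤ)) fun j _ => hεA j
          simpa using this
        have h1 : 1 ≤ ∏ j ∈ t, ε j ^ m j := one_le_prod_pow t m
        rw [Finset.prod_insert hi, Finset.sum_insert hi]
        have hmul := CarrierSiegeK8.carrierA_mul_mem_relationsLE hR ((hεA i).pow (m i)) halg hc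
          (one_le_pow₀ (hε1 i).le) h1
        rw [← QuotientAddGroup.eq_zero_iff] at hmul
        change QuotientAddGroup.mk' (relationsLE 1) _ = 0 at hmul
        rw [map_sub, map_sub, sub_sub, sub_eq_zero] at hmul
        rw [hmul, ih', carrierA_pow_eq hR (hεA i) hc (hε1 i).le]
    exact key Finset.univ
  -- `Λ(u) + Λ(B) = Λ(A)`
  have hmulAB := CarrierSiegeK8.carrierA_mul_mem_relationsLE hR huA hBalg hc hu1 hB1
  rw [huB] at hmulAB
  rw [← QuotientAddGroup.eq_zero_iff] at hmulAB
  change QuotientAddGroup.mk' (relationsLE 1) _ = 0 at hmulAB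
  rw [map_sub, map_sub, sub_sub, sub_eq_zero] at hmulAB
  have hAeq := hprod np
  have hBeq := hprod nm
  rw [← hA] at hAeq
  rw [← hB] at hBeq
  have : QuotientAddGroup.mk' (relationsLE 1) (of (RA 1 u c)) =
      QuotientAddGroup.mk' (relationsLE 1) (of (RA 1 A c)) - QuotientAddGroup.mk' (relationsLE 1) (of (RA 1 B c)) := by
    rw [hmulAB]; abel
  rw [this, hAeq, hBeq, ← Finset.sum_sub_distrib]
  refine Finset.sum_congr rfl fun i _ => ?_
  rw [hsplitn i, sub_smul, natCast_zsmul, natCast_zsmul]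

/-- **Box vanishing in dimension one for denominators split over the real algebraic numbers.**
Let `N = [(0,1), p/q]` with `p, q ∈ ℚ[X]`, all complex roots of `q` REAL (so real algebraic:
`(q.map (algebraMap ℚ K)).Splits`, `K = algebraicClosure ℚ ℝ`) and off `[0,1]`. If `N.value = 0`
then `[N] ∈ KZ.relationsLE 1` (registered sub-goal of crux stmt-KontsevichZagierPeriods-12475, port
of `PiBox.Dlog.box_algsplit_mem_relations`). Proof: algebraic normal form `[pt, r] + Σⱼ Λ(uⱼ, cⱼ)` (`nfA_of_split`);
re-expand the `uⱼ` on a multiplicative basis `εᵢ` with `ℚ`-independent logarithms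
(`exists_mulBasis`, `carrierA_monomial_eq`) and merge: `[pt, r] + Σᵢ Λ(εᵢ, Cᵢ)` with algebraic
`r, Cᵢ`; the value `r + Σ Cᵢ log εᵢ` vanishes, so by Baker (`eq_zero_of_alg_add_sum_mul_log_eq_zero`)
`r = 0` and all `Cᵢ = 0`. This is the real-algebraic-pole layer of the registered stub
`stub_boxRigidity` (`m = 1`) and of item stmt-KontsevichZagierPeriods-10622.
(inside the budget `relationsLE 1`) [cite: KontsevichZagier2001, §1.2 Conjecture 1] -/
theorem box_algsplit_mem_relationsLE : ∀ (p q : Polynomial ℚ), q ≠ 0 →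
    (q.map (algebraMap ℚ (algebraicClosure ℚ ℝ))).Splits →
    (∀ t ∈ Set.Icc (0:ℝ) 1, (Polynomial.aeval t q : ℝ) ≠ 0) →
    ∀ (N : KZ.IntegralRep 1), N.domain = {x | x 0 ∈ Set.Ioo (0:ℝ) 1} →
    Set.EqOn N.integrand (fun x => (Polynomial.aeval (x 0) p : ℝ) / Polynomial.aeval (x 0) q)
      N.domain →
    N.value = 0 → KZ.of N ∈ KZ.relationsLE 1 := by
  intro p q hq hsplit hq01 N hNd hNi hv
  classical
  obtain ⟨RA, hR⟩ := exists_carrierA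
  obtain ⟨ZA, hZ⟩ := exists_ptCarrierA
  set K := algebraicClosure ℚ ℝ
  set pK : K[X] := p.map (algebraMap ℚ K) with hpK
  set qK : K[X] := q.map (algebraMap ℚ K) with hqK
  have hqK0 : qK ≠ 0 := (Polynomial.map_ne_zero_iff (algebraMap ℚ K).injective).mpr hq
  have haevq : ∀ t : ℝ, (Polynomial.aeval t qK : ℝ) = Polynomial.aeval t q := fun t =>
    Polynomial.aeval_map_algebraMap K t q
  have haevp : ∀ t : ℝ, (Polynomial.aeval t pK : ℝ) = Polynomial.aeval t p := fun t =>
    Polynomial.aeval_map_algebraMap K t p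
  obtain ⟨r, k, u, c, hr, hu1, hu, hc, hEq⟩ :=
    nfA_of_split hR hZ qK.natDegree pK qK N hqK0 le_rfl hsplit
      (fun t ht => by rw [haevq]; exact hq01 t ht) hNd
      (fun x hx => by
        rw [hNi hx]
        show (Polynomial.aeval (x 0) p : ℝ) / Polynomial.aeval (x 0) q =
          Polynomial.aeval (x 0) pK / Polynomial.aeval (x 0) qK
        rw [haevp, haevq])
  -- multiplicative basis for the `u j`
  obtain ⟨s, ε, n, hε1, hεA, hli, hmon⟩ :=
    exists_mulBasis u (fun j => lt_trans one_pos (hu1 j)) hu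
  have hε0 : ∀ i, 0 < ε i := fun i => lt_trans one_pos (hε1 i)
  -- the collected coefficients
  set C : Fin s → ℝ := fun i => ∑ j, (n j i : ℝ) * c j with hC
  have hCA : ∀ i, IsAlgebraic ℚ (C i) := fun i =>
    Finset.sum_induction _ (IsAlgebraic ℚ) (fun _ _ ha hb => ha.add hb) isAlgebraic_zero fun j _ => (isAlgebraic_int (R := ℚ) (n j i)).mul (hc j)
  have hclass : QuotientAddGroup.mk' (relationsLE 1) (of N) = QuotientAddGroup.mk' (relationsLE 1) (of (ZA r)) +
      ∑ i, QuotientAddGroup.mk' (relationsLE 1) (of (RA 1 (ε i) (C i))) := by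
    rw [hEq]
    congr 1
    have h1 : ∀ j, QuotientAddGroup.mk' (relationsLE 1) (of (RA 1 (u j) (c j))) =
        ∑ i, QuotientAddGroup.mk' (relationsLE 1) (of (RA 1 (ε i) ((n j i : ℝ) * c j))) := by
      intro j
      rw [carrierA_monomial_eq hR ε hε1 hεA (n j) (hu1 j).le (hu j) (hc j) (hmon j)]
      refine Finset.sum_congr rfl fun i _ => ?_
      rw [carrierA_zsmul_eq hR (hεA i) (hc j)]
    rw [Finset.sum_congr rfl fun j _ => h1 j, Finset.sum_comm]
    refine Finset.sum_congr rfl fun i _ => ?_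
    show _ = QuotientAddGroup.mk' (relationsLE 1) (of (RA 1 (ε i) (∑ j, (n j i : ℝ) * c j)))
    rw [carrierA_sum_eq _ _ hR (hεA i) fun j _ => (isAlgebraic_int (R := ℚ) (n j i)).mul (hc j)]
  -- the representative and its value
  have hrep : of N - (of (ZA r) + ∑ i, of (RA 1 (ε i) (C i))) ∈ relationsLE 1 := by
    rw [← QuotientAddGroup.eq_zero_iff]
    change QuotientAddGroup.mk' (relationsLE 1) _ = 0
    rw [map_sub, map_add, map_sum, hclass, sub_self]
  have hval : r + ∑ i, C i * Real.log (ε i) = 0 := by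
    have h := Budget.eval_eq_zero_of_mem_relationsLE hrep
    rw [map_sub, map_add, map_sum, eval_of, hv, zero_sub, neg_eq_zero] at h
    rw [← h, eval_of, value_pt (ZA r) (hZ r hr).1 (hZ r hr).2]
    congr 1
    refine Finset.sum_congr rfl fun i _ => ?_
    have hRi := hR 1 (ε i) (C i) isAlgebraic_one (hεA i) (hCA i) one_pos
    have hEqOn : EqOn (RA 1 (ε i) (C i)).integrand (fun x => C i / x 0) (RA 1 (ε i) (C i)).domain := by
      rw [hRi.2]; exact fun _ _ => rfl
    rw [eval_of, value_dlogA (RA 1 (ε i) (C i)) hRi.1 hEqOn one_pos (hε1 i).le, div_one]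
  obtain ⟨hr0, hC0⟩ := eq_zero_of_alg_add_sum_mul_log_eq_zero ε hε0 hεA hli r hr C hCA hval
  -- conclude
  rw [← QuotientAddGroup.eq_zero_iff]
  change QuotientAddGroup.mk' (relationsLE 1) _ = 0
  rw [hclass, hr0]
  have hZ0 : QuotientAddGroup.mk' (relationsLE 1) (of (ZA 0)) = 0 :=
    (QuotientAddGroup.eq_zero_iff _).mpr (pt_zero_mem_relationsLE (ZA 0) (hZ 0 isAlgebraic_zero).2)
  rw [hZ0, zero_add]
  refine Finset.sum_eq_zero fun i _ => ?_
  rw [hC0 i]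
  exact (QuotientAddGroup.eq_zero_iff _).mpr (carrierA_zero_mem_relationsLE hR (hεA i))

/-- **Box rigidity in dimension one for denominators with real (algebraic) roots.** Two
representations on the open unit slab with integrands `p/q`, `p'/q'` (`p, q, p', q' ∈ ℚ[X]`, all roots
of `q`, `q'` real and off `[0,1]`) and equal values are KZ-equivalent INSIDE DIMENSION ONE
(`KZ.EquivalentLE 1`) — the real-root instance
(`m = m' = 1`) of the registered stub `stub_boxRigidity`; values here are `ℚ̄ + Σ ℚ̄ log ℚ̄`, e.g.
`∫₀¹ dx/(x² + 3x + 1)`. Input: Baker's theorem (`baker_holds`). (inside the budget `relationsLE 1`) [cite: KontsevichZagier2001, §1.2 Conjecture 1] -/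
theorem box_realsplit_equivalentLE_of_value_eq (p q p' q' : ℚ[X]) (hq : q ≠ 0)
    (hsplit : (q.map (algebraMap ℚ ℝ)).Splits)
    (hq01 : ∀ t ∈ Set.Icc (0:ℝ) 1, (Polynomial.aeval t q : ℝ) ≠ 0)
    (hq' : q' ≠ 0) (hsplit' : (q'.map (algebraMap ℚ ℝ)).Splits)
    (hq'01 : ∀ t ∈ Set.Icc (0:ℝ) 1, (Polynomial.aeval t q' : ℝ) ≠ 0)
    (N N' : IntegralRep 1) (hNd : N.domain = {x | x 0 ∈ Set.Ioo (0:ℝ) 1})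
    (hNi : EqOn N.integrand (fun x => (Polynomial.aeval (x 0) p : ℝ) / Polynomial.aeval (x 0) q)
      N.domain)
    (hN'd : N'.domain = {x | x 0 ∈ Set.Ioo (0:ℝ) 1})
    (hN'i : EqOn N'.integrand (fun x => (Polynomial.aeval (x 0) p' : ℝ) / Polynomial.aeval (x 0) q')
      N'.domain)
    (hv : N.value = N'.value) : EquivalentLE 1 N N' := by
  have hqq01 : ∀ t ∈ Set.Icc (0:ℝ) 1, (Polynomial.aeval t (q * q') : ℝ) ≠ 0 := fun t ht => by
    rw [map_mul]; exact mul_ne_zero (hq01 t ht) (hq'01 t ht)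
  obtain ⟨D, hDd, hDi⟩ := exists_rep_unit (p * q' - p' * q) (q * q') hqq01
  obtain ⟨M, hMd, hMi⟩ := exists_rep_unit (-p') q' hq'01
  have h1 : of D - of N - of M ∈ relationsLE 1 := by
    refine mem_relationsLE_of_integrandAdd le_rfl (by rw [hNd, hDd]) (by rw [hMd, hDd]) fun x hx => ?_
    have hx' : x 0 ∈ Set.Icc (0:ℝ) 1 := by rw [hDd] at hx; exact Set.Ioo_subset_Icc_self hx
    rw [Pi.add_apply, hDi, hMi, hNi (by rw [hNd, ← hDd]; exact hx)]
    simp only [map_sub, map_mul, map_neg]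
    have h1 := hq01 _ hx'
    have h2 := hq'01 _ hx'
    field_simp
    ring
  have h2 : of N' + of M ∈ relationsLE 1 :=
    Kit.of_add_of_mem_relationsLE_of_eqOn_neg le_rfl (by rw [hMd, hN'd]) fun x hx => by
      rw [hMi, Pi.neg_apply, hN'i hx]
      simp [neg_div]
  have hvM : M.value = -N'.value := by
    have h := Budget.eval_eq_zero_of_mem_relationsLE h2
    rw [map_add, eval_of, eval_of] at h
    linarith
  have hvD : D.value = 0 := by
    have h := Budget.eval_eq_zero_of_mem_relationsLE h1
    rw [map_sub, map_sub, eval_of, eval_of, eval_of] at h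
    linarith
  have hsplit2 : ((q * q').map (algebraMap ℚ ℝ)).Splits := by
    rw [Polynomial.map_mul]; exact hsplit.mul hsplit'
  have h3 : of D ∈ relationsLE 1 :=
    box_algsplit_mem_relationsLE _ _ (mul_ne_zero hq hq')
      (splits_algClosure_of_splits_real _ (mul_ne_zero hq hq') hsplit2) hqq01 D hDd
      (by rw [hDi]; exact fun _ _ => rfl) hvD
  have : of N - of N' = of D - (of D - of N - of M) - (of N' + of M) := by abel
  show of N - of N' ∈ relationsLE 1
  rw [this]
  exact (relationsLE 1).sub_mem ((relationsLE 1).sub_mem h3 h1) h2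

end Dlog


end Summit.KontsevichZagierPeriods.AbelContraction.RealHyperellipticSector.Port

end
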